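import Literature.NumberTheory.CubicFields.PureCubicLexMinProgram
import Literature.Computability.Complexity.CodeFPModArith
import Literature.Computability.QuantumComplexity.GramSchmidtTableMachine
import HarnessLib

/-!
# The program `lexE`: sizes, the scan range and the precision budget

Topic `NumberTheory/CubicFields`, sub-namespace `PureCubicLexMin`. Arithmetic side conditions of the
correctness proof of `lexE` (`PureCubicLexMinProgram.lean`), all read off the length `L` of the input
code `inE ((a, b), (den, [h11, …, h33]))`:

* `length_inE`, `bounds_of_input` (with `CodeFP.lt_two_pow_length_natE`,
  `QuantumComplexity.natAbs_lt_two_pow_length_intE`) :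
  `a, b, den, |hᵢⱼ| < 2ᴸ` and `|bin a| + |bin b| + |bin den| + |code h| + 5 ≤ L` for each entry `h`;
* `int_log_lower`, `int_log_upper` : the dyadic scale `s = ⌊log₂ x⌋` of a real `x` with
  `2^{−M} < x < 2^{M'}` satisfies `−M ≤ s < M'`;
* `inv_two_pow_natAbs_le_min` : `2^{−|s|} ≤ min ((2ˢ)⁻¹, 1)`;
* **`budget_ineq`** : `2592 · 2^{2k} (ab)³ h³ den ≤ 2^{16L+64}` when `a, b, den, h < 2ᴸ` and
  `k ≤ 3L + 8` — so the rounding precision `N = budget` makes `24 δ ≤ μ` (`precision_ineq`).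

## References

* H. Cohen, *A Course in Computational Algebraic Number Theory*, GTM 138 (1993), §6.5. [Cohen1993]
-/

namespace Literature.NumberTheory.CubicFields

namespace PureCubicLexMin

open Literature.Computability.Complexity Literature.Computability.Complexity.CodeFP
  Literature.Computability.QuantumComplexity

/-! ### Lengths of the input code -/

/-- **The length of the input code** `⟨⟨bin a, bin b⟩, ⟨bin den, ⟪hs⟫⟩⟩`. [folklore] -/
theorem length_inE (a b den : ℕ) (hs : List ℤ) :
    (inE ((a, b), (den, hs))).length =
      2 * (2 * (natE a).length + 2 + (natE b).length) + 2 + (2 * (natE den).length + 2 + (rawE intE hs).length) := by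
  simp [pairE, length_boolPair]

/-- **Sizes of the components of an input** in terms of the length `L` of its code. [folklore] -/
theorem bounds_of_input (a b den : ℕ) (hs : List ℤ) :
    a < 2 ^ (inE ((a, b), (den, hs))).length ∧ b < 2 ^ (inE ((a, b), (den, hs))).length ∧
    den < 2 ^ (inE ((a, b), (den, hs))).length ∧
    (∀ h ∈ hs, h.natAbs < 2 ^ (inE ((a, b), (den, hs))).length) ∧
    (natE a).length + (natE b).length + (natE den).length + 5 ≤ (inE ((a, b), (den, hs))).length ∧
    (∀ h ∈ hs, (natE a).length + (natE b).length + (intE h).length + 5 ≤ (inE ((a, b), (den, hs))).length) := by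
  have hL := length_inE a b den hs
  set L := (inE ((a, b), (den, hs))).length with hLdef
  have hitem : ∀ h ∈ hs, 2 * (intE h).length + 2 ≤ (rawE intE hs).length := fun h hm =>
    length_item_le_length_rawE intE hm
  have pa : (natE a).length ≤ L := by omega
  have pb : (natE b).length ≤ L := by omega
  have pd : (natE den).length ≤ L := by omega
  refine ⟨?_, ?_, ?_, ?_, by omega, fun h hm => by have := hitem h hm; omega⟩
  · exact lt_of_lt_of_le (lt_two_pow_length_natE a) (Nat.pow_le_pow_right (by norm_num) pa)
  · exact lt_of_lt_of_le (lt_two_pow_length_natE b) (Nat.pow_le_pow_right (by norm_num) pb)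
  · exact lt_of_lt_of_le (lt_two_pow_length_natE den) (Nat.pow_le_pow_right (by norm_num) pd)
  · intro h hm
    have := hitem h hm
    exact lt_of_lt_of_le (natAbs_lt_two_pow_length_intE h) (Nat.pow_le_pow_right (by norm_num) (by omega))

/-! ### The dyadic scale of a real number -/

/-- If `2^{−M} < x` then `−M ≤ ⌊log₂ x⌋`. [folklore] -/
theorem int_log_lower {x : ℝ} {M : ℕ} (hx : ((2 : ℝ) ^ M)⁻¹ < x) : -(M : ℤ) ≤ Int.log 2 x := by
  have hpos : (0 : ℝ) < ((2 : ℝ) ^ M)⁻¹ := by positivity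
  have h := Int.log_mono_right (b := 2) hpos hx.le
  have hlog : Int.log 2 (((2 : ℝ) ^ M)⁻¹) = -(M : ℤ) := by
    rw [← zpow_natCast, ← zpow_neg]
    exact_mod_cast Int.log_zpow (R := ℝ) (b := 2) (by norm_num) (-(M : ℤ))
  rwa [hlog] at h

/-- If `0 < x < 2^{M}` then `⌊log₂ x⌋ < M`. [folklore] -/
theorem int_log_upper {x : ℝ} (hx0 : 0 < x) {M : ℕ} (hx : x < (2 : ℝ) ^ M) : Int.log 2 x < M := by
  rw [← Int.lt_zpow_iff_log_lt (by norm_num : 1 < 2) hx0]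
  exact_mod_cast hx

/-- The scale `X = 2ˢ` brackets `x`: `X ≤ x < 2X` for `s = ⌊log₂ x⌋`, `x > 0`. [folklore] -/
theorem zpow_log_le_and_lt {x : ℝ} (hx : 0 < x) :
    (2 : ℝ) ^ Int.log 2 x ≤ x ∧ x < 2 * (2 : ℝ) ^ Int.log 2 x := by
  refine ⟨?_, ?_⟩
  · exact_mod_cast Int.zpow_log_le_self (b := 2) (by norm_num) hx
  · have h := Int.lt_zpow_succ_log_self (b := 2) (by norm_num : 1 < 2) x
    rw [zpow_add_one₀ (by norm_num : ((2 : ℕ) : ℝ) ≠ 0)] at h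
    push_cast at h
    linarith

/-- `2^{−|s|} ≤ min ((2ˢ)⁻¹, 1)`. [folklore] -/
theorem inv_two_pow_natAbs_le_min (s : ℤ) : ((2 : ℝ) ^ s.natAbs)⁻¹ ≤ min ((2 : ℝ) ^ s)⁻¹ 1 := by
  have h1 : ((2 : ℝ) ^ s.natAbs)⁻¹ ≤ 1 := by
    rw [inv_le_one_iff₀]; exact Or.inr (one_le_pow₀ (by norm_num))
  refine le_min ?_ h1
  rcases le_or_gt 0 s with hs | hs
  · have : (2 : ℝ) ^ s = 2 ^ s.natAbs := by
      rw [← zpow_natCast, Int.natCast_natAbs, abs_of_nonneg hs]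
    rw [this]
  · have : (2 : ℝ) ^ s = (2 ^ s.natAbs)⁻¹ := by
      rw [← zpow_natCast, Int.natCast_natAbs, abs_of_neg hs, zpow_neg, inv_inv]
    rw [this, inv_inv]
    exact h1.trans (one_le_pow₀ (by norm_num))

/-! ### The precision budget -/

/-- **The budget inequality**: `2592 · 2^{2k} (ab)³ h³ den ≤ 2^{16L+64}` for `a, b, den, h < 2ᴸ`
and `k ≤ 3L + 8` (`12 + (6L + 16) + 6L + 3L + L ≤ 16L + 64`). [folklore] -/
theorem budget_ineq {L a b den h k : ℕ} (ha : a < 2 ^ L) (hb : b < 2 ^ L) (hd : den < 2 ^ L)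
    (hh : h < 2 ^ L) (hk : k ≤ 3 * L + 8) :
    (2592 : ℝ) * 2 ^ (2 * k) * ((a : ℝ) * b) ^ 3 * (h : ℝ) ^ 3 * den ≤ 2 ^ (16 * L + 64) := by
  have h2 : (0 : ℝ) < 2 := by norm_num
  have e0 : (2592 : ℝ) ≤ 2 ^ 12 := by norm_num
  have e1 : (2 : ℝ) ^ (2 * k) ≤ 2 ^ (6 * L + 16) := pow_le_pow_right₀ (by norm_num) (by omega)
  have hab : (a : ℝ) * b ≤ 2 ^ (2 * L) := by
    have : ((a * b : ℕ) : ℝ) ≤ ((2 ^ L * 2 ^ L : ℕ) : ℝ) := by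
      exact_mod_cast Nat.mul_le_mul ha.le hb.le
    push_cast at this
    rw [two_mul, pow_add]; exact this
  have e2 : ((a : ℝ) * b) ^ 3 ≤ 2 ^ (6 * L) := by
    calc ((a : ℝ) * b) ^ 3 ≤ (2 ^ (2 * L)) ^ 3 := pow_le_pow_left₀ (by positivity) hab 3
      _ = 2 ^ (6 * L) := by rw [← pow_mul]; ring_nf
  have e3 : (h : ℝ) ^ 3 ≤ 2 ^ (3 * L) := by
    have hh' : (h : ℝ) ≤ 2 ^ L := by exact_mod_cast hh.le
    calc (h : ℝ) ^ 3 ≤ (2 ^ L) ^ 3 := pow_le_pow_left₀ (by positivity) hh' 3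
      _ = 2 ^ (3 * L) := by rw [← pow_mul]; ring_nf
  have e4 : (den : ℝ) ≤ 2 ^ L := by exact_mod_cast hd.le
  calc (2592 : ℝ) * 2 ^ (2 * k) * ((a : ℝ) * b) ^ 3 * (h : ℝ) ^ 3 * den
      ≤ 2 ^ 12 * 2 ^ (6 * L + 16) * 2 ^ (6 * L) * 2 ^ (3 * L) * 2 ^ L := by
        gcongr
    _ = 2 ^ (16 * L + 28) := by rw [← pow_add, ← pow_add, ← pow_add, ← pow_add]; ring_nf
    _ ≤ 2 ^ (16 * L + 64) := pow_le_pow_right₀ (by norm_num) (by omega)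

/-- **The precision makes the perturbation small**: with `δ = 6 · 2ᵏ h (ab) / 2ᴺ` and
`μ = min((2ˢ)⁻¹, 1) / (18 (ab)² h² den)`, `k = |s| ≤ 3L + 8`, `N = 16L + 64` and
`a, b, den, h < 2ᴸ` (`h ≥ 1`, `ab ≥ 1`, `den ≥ 1`): `24 δ ≤ μ`. [cite: Cohen1993, §6.5] -/
theorem precision_ineq {L a b den h : ℕ} (ha : a < 2 ^ L) (hb : b < 2 ^ L) (hd : den < 2 ^ L)
    (hh : h < 2 ^ L) (ha1 : 1 ≤ a) (hb1 : 1 ≤ b) (hd1 : 1 ≤ den) (hh1 : 1 ≤ h)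
    (s : ℤ) (hk : s.natAbs ≤ 3 * L + 8) :
    24 * (6 * 2 ^ s.natAbs * (h : ℝ) * ((a : ℝ) * b) / 2 ^ (16 * L + 64)) ≤
      min ((2 : ℝ) ^ s)⁻¹ 1 / (18 * ((a : ℝ) * b) ^ 2 * (h : ℝ) ^ 2 * den) := by
  have hmin := inv_two_pow_natAbs_le_min s
  have hB := budget_ineq ha hb hd hh hk
  set k := s.natAbs with hkdef
  have ha' : (1 : ℝ) ≤ a := by exact_mod_cast ha1
  have hb' : (1 : ℝ) ≤ b := by exact_mod_cast hb1
  have hd' : (1 : ℝ) ≤ den := by exact_mod_cast hd1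
  have hh' : (1 : ℝ) ≤ h := by exact_mod_cast hh1
  have hab' : (1 : ℝ) ≤ (a : ℝ) * b := one_le_mul_of_one_le_of_one_le ha' hb'
  have hden18 : (0 : ℝ) < 18 * ((a : ℝ) * b) ^ 2 * (h : ℝ) ^ 2 * den := by positivity
  have hN : (0 : ℝ) < 2 ^ (16 * L + 64) := by positivity
  have hk2 : (0 : ℝ) < 2 ^ k := by positivity
  -- reduce to the budget inequality
  refine le_trans ?_ (div_le_div_of_nonneg_right hmin hden18.le)
  rw [← mul_div_assoc, show ((2 : ℝ) ^ k)⁻¹ / (18 * ((a : ℝ) * b) ^ 2 * (h : ℝ) ^ 2 * den) =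
    1 / (2 ^ k * (18 * ((a : ℝ) * b) ^ 2 * (h : ℝ) ^ 2 * den)) by rw [inv_eq_one_div, div_div],
    div_le_div_iff₀ hN (by positivity), one_mul]
  have key : 24 * (6 * 2 ^ k * (h : ℝ) * ((a : ℝ) * b)) * (2 ^ k * (18 * ((a : ℝ) * b) ^ 2 * (h : ℝ) ^ 2 * den)) =
      2592 * 2 ^ (2 * k) * ((a : ℝ) * b) ^ 3 * (h : ℝ) ^ 3 * den := by
    rw [two_mul, pow_add]; ring
  rw [key]
  exact hB

end PureCubicLexMin

end Literature.NumberTheory.CubicFields
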